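/-
Copyright (c) 2026 the pub-hodgecm-mathlib formalisation cell (harness21).  Prover seat hodgecm-mathlib-K2E2-p12 (g4): Track B «K2-LIT», ENGINE E1
(released to E1 by K2-lead R24), h413 = stmt-HodgeConjecture-24833; DEAL «R7₂-SCALAR» of K2E1-plan (g4) 2026-09-04T06:35:49Z, FILE 1.
-/
import Summits.HodgeConjecture.HodgeConjecture.Theorems.F0P2wPartialDedekindZetaPole          -- ★ partial Dedekind zeta: Euler product, `ζ·E_S` factorisation, pole at `1`, Landau non-vanishing
import Summits.HodgeConjecture.HodgeConjecture.Theorems.K2LiuSiegelIntertwiningScalarGL1      -- ★ O41.6 (K2Liu-p07): generic `differentiable_update_sub_one_mul_zeta` (`(w−1)ζ_F^S(w)` entire), the template of this file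
import HarnessLib

/-!
# K2·E1 — `K2E1IntertwiningScalarContinuationU2`: THE UNRAMIFIED SCALAR `c^S(σ) = ζ_F^S(2σ−1)/ζ_F^S(2σ)` OF THE STANDARD INTERTWINING
# OPERATOR OF `U(J₂)` — Euler product on `Re σ > 1`, continuation to `Re σ > ½` with EXACTLY ONE POLE, simple, at `σ = 1 = 2ρ_H`

Track B ∕ K2-LIT, crux h413 = `stmt-HodgeConjecture-24833`, route of record `HCCMUnconditional`; cell `hodgecm-mathlib`, squad K2, ENGINE E1 (campaign «EIS-RANK-ONE»,
ceiling R7 «continuation of the intertwining operator» at `N = 2`).  DEAL «R7₂-SCALAR» (K2E1-plan (g4) 2026-09-04T06:35:49Z), FILE 1 of 3: the GL₁ analysis.  THEOREMS ONLY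
(no `def`, no instance, no notation, no named-fact hypothesis, no `sorry`; default heartbeats); lane `--supports stmt-HodgeConjecture-24833 --as helper` (count-neutral).

THE OBJECT.  At `U(J₂)` (`2ρ_H = 1`) the standard intertwining constant of ★ `K2E1IntertwiningGrowthU2.integral_borelHeight_weylLongU_mul_rpow_eq`
(`∫_{N(𝔸)} H(w₀ v g)^σ dν = c(σ)·H(g)^{1−σ}`, `c(σ) = ∫_{N(𝔸)} H(w₀ v)^σ dν`) has, at every finite place `v` of `F = L⁺` where the line is unramified and `dt(𝒪_v) = 1`, the local
factor `∫_{F_v} max(1, |t|_v)^{−2σ} dt = 1 + (1 − q_v⁻¹) Σ_{k ≥ 1} q_v^{k(1−2σ)} = (1 − q_v^{−2σ})/(1 − q_v^{1−2σ}) = ζ_v(2σ−1)/ζ_v(2σ)` (inert ∕ ramified `w ∣ v`: `|t|_w = |t|_v²`; split: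
two `w`, each `|t|_v` — the same closed form; FILE 2 `K2E1IntertwiningLocalFactorU2`), i.e. K2Liu's `a₁(s)/b₁(s) = L(2s, χ⁰)/L(2s+1, χ⁰)` at `n = 1`, `σ = s + ½`, TRIVIAL `χ⁰`
([Harris2007 (1.3.4)]; ★ `K2LiuSiegelIntertwiningScalarGL1` is the PARITY case `χ⁰ = ε ≠ 1` — this file is the `χ⁰ = 1` twin, where the numerator `ζ(2σ−1)` DOES have its pole).
So the unramified global scalar is  **`c^S(σ) = ζ_F^S(2σ−1) / ζ_F^S(2σ)`**,  `ζ_F^S(w) = partialStandardL S (fun _ => {1}) w` (★, Euler product off `S`).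

WHAT IS PROVED — pure GL₁ analysis, for ANY number field `F` and ANY set `S` of finite places (finite where said):
* §1 **`hasProd_localScalar`** (`Re σ > 1`): `∏'_{v ∉ S} (1 − q_v^{−2σ})(1 − q_v^{−(2σ−1)})⁻¹` `HasProd`-converges to `c^S(σ)`, which is `≠ 0` (★ `hasProd_partialDedekindZeta` at `2σ − 1`
  and, inverted, at `2σ`).
* §2 **`differentiableOn_zeta_two_mul`**, **`zeta_two_mul_ne_zero`**: the denominator `σ ↦ ζ_F^S(2σ)` is holomorphic and zero-free on the open half-plane `Re σ > ½` (Euler product).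
* §3 **`exists_entire_sub_one_mul_num`** (`S` finite): `(σ − 1)·ζ_F^S(2σ−1) = A(σ)` on `Re σ > 1` with `A` ENTIRE and `A(1) = ½·ρ_F·E_S(1) ≠ 0` (`A(σ) = ½·[(w − 1)ζ_F(w)E_S(w)]_{w = 2σ−1}`,
  ★ `differentiable_update_sub_one_mul_zeta`, ★ `residue_mul_thinEulerFactor_ne_zero`).
* §4 MAIN **`exists_differentiableOn_sub_one_mul_scalar`** (`S` finite): `∃ G` HOLOMORPHIC ON `{Re σ > ½}` with **`(σ − 1)·c^S(σ) = G(σ)` for `Re σ > 1`** and **`G(1) ≠ 0`** — the scalar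
  continues meromorphically to `Re σ > ½` with EXACTLY ONE pole there, SIMPLE, at `σ = 1 = 2ρ_H`, residue `G(1) = ½ρ_F E_S(1)/ζ_F^S(2)`: the scalar heart of (H4-b)₂ (finiteness of
  the residual exponents at `N = 2`, trivial `K`-type).
* §5 **`exists_continuation_den_boundary`** (`S` finite): `B(σ) = ζ_F(2σ)·E_S(2σ)` is holomorphic on `{Re σ > 0} ∖ {½}`, `= ζ_F^S(2σ)` on `Re σ > ½`, has NO ZERO on `Re σ ≥ ½`, `σ ≠ ½`
  (Landau: `ζ_F(1 + it) ≠ 0`), and `(σ − ½)·B(σ) → r ≠ 0` on `𝓝[≠] ½` (the simple pole of `ζ_F(2σ)` at `σ = ½`).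
* §6 **`exists_continuousOn_inv_den`** (`S` finite): `1/ζ_F^S(2σ)` extends CONTINUOUSLY to the CLOSED half-plane `Re σ ≥ ½`, with its only zero at `σ = ½`.
HOW E1 USES IT: R7₂ = «the constant term `f_z + c(Re?)…`»: the poles of `M(w₀)f_σ` on `Re σ > ½` at unramified level are those of `c^S(σ)·c_∞(σ)·∏_{v∈S} c_v(σ)`; §4 pins the
unramified part to the single simple pole `σ = 1`.  The VECTOR-valued continuation (bad places, `K`-types), the archimedean factor and R8 stay ceiling: this file alone does not pay
5Res ∕ 12R3; FILE 3 (Euler product `c(σ) = c_∞(σ)·∏_v c_v(σ)`, adelic Fubini) is a census.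
HONEST LABEL: HC_CM is proved only modulo the 7 printed citations (2 remaining named inputs: hLiu418 = `stmt-HodgeConjecture-24832`, h413 = `stmt-HodgeConjecture-24833`) until rung 0
closes; this file asserts no named fact and closes no socket; count-neutral.

## References
* [MoeglinWaldspurger1995] C. Mœglin, J.-L. Waldspurger, *Spectral Decomposition and Eisenstein Series* (1995): II.1.6–II.1.7, IV.1.11 (rank-one intertwining constants).
* [Harris2007] M. Harris, *Cohomological automorphic forms on unitary groups, II* (Howe volume, 2007): (1.3.4) p. 92 (`a_n(s)/b_n(s)`, here `n = 1`).
* [GindikinKarpelevich1962] S. G. Gindikin, F. I. Karpelevič, Dokl. Akad. Nauk SSSR 145 (1962) 252–255 (the local `c`-function).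
* [NeukirchANT1999] J. Neukirch, *Algebraic Number Theory* (1999): Ch. VII (5.2), Cor. (5.11) (Euler product, simple pole of `ζ_F` at `1`), §8.
* [Langlands1976] R. P. Langlands, *On the Functional Equations Satisfied by Eisenstein Series*, LNM 544 (1976): Appendix (rank one, `ξ(2σ−1)/ξ(2σ)`).
-/

set_option autoImplicit false
set_option linter.dupNamespace false -- the mandated namespace repeats `HodgeConjecture.HodgeConjecture`

noncomputable section

open scoped NNReal
open Filter Topology Complex NumberField IsDedekindDomain
open Literature.NumberTheory.Automorphic Literature.NumberTheory.LFunctions Literature.NumberTheory.GaloisRepresentations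

namespace Summit.HodgeConjecture.HodgeConjecture.Cruxes.H413.K2E1IntertwiningScalarContinuationU2

open Summit.HodgeConjecture.HodgeConjecture.Cruxes.H413.F0P2wPartialDedekindZetaPole
open Summit.HodgeConjecture.HodgeConjecture.Cruxes.HLiu418.K2LiuSiegelIntertwiningScalarGL1 (differentiable_update_sub_one_mul_zeta)

variable {F : Type} [Field F] [NumberField F] {S : Set (HeightOneSpectrum (𝓞 F))}

/-! ## §0 Bookkeeping: real parts of `2σ`, `2σ − 1` -/

/-- `re (2σ) = 2 re σ` and `re (2σ − 1) = 2 re σ − 1`. [folklore] -/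
theorem re_two_mul_and_sub_one (σ : ℂ) : (2 * σ).re = 2 * σ.re ∧ (2 * σ - 1).re = 2 * σ.re - 1 := by
  simp [Complex.mul_re]

/-! ## §1 `Re σ > 1`: the Euler product of the local scalars is `ζ_F^S(2σ−1)/ζ_F^S(2σ)` -/

/-- **THE EULER PRODUCT OF THE LOCAL SCALARS IS `c^S(σ) = ζ_F^S(2σ−1)/ζ_F^S(2σ)`, `Re σ > 1`.**  At an unramified `v ∉ S` the local intertwining scalar of `U(J₂)` at
the trivial `K_v`-type is `∫_{F_v} max(1,|t|_v)^{−2σ} dt = ζ_v(2σ−1)/ζ_v(2σ) = (1 − q_v^{−2σ})·(1 − q_v^{−(2σ−1)})⁻¹`; the product over `v ∉ S` `HasProd`-converges to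
`ζ_F^S(2σ−1)/ζ_F^S(2σ)`, which is `≠ 0` (★ `hasProd_partialDedekindZeta` at `2σ − 1`, and at `2σ` inverted with `Finset.prod_inv_distrib`).
[cite: Harris2007, (1.3.4) p. 92] [cite: NeukirchANT1999, Ch. VII (5.2)] -/
theorem hasProd_localScalar {σ : ℂ} (hσ : 1 < σ.re) :
    HasProd (fun v : {v : HeightOneSpectrum (𝓞 F) // v ∉ S} =>
        (1 - (v.1.residueCard : ℂ) ^ (-(2 * σ))) * (1 - (v.1.residueCard : ℂ) ^ (-(2 * σ - 1)))⁻¹)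
      (partialStandardL S (fun _ => {1}) (2 * σ - 1) / partialStandardL S (fun _ => {1}) (2 * σ)) ∧
    partialStandardL S (fun _ => {1}) (2 * σ - 1) / partialStandardL S (fun _ => {1}) (2 * σ) ≠ 0 := by
  obtain ⟨h2, h2m1⟩ := re_two_mul_and_sub_one σ
  have hnum := hasProd_partialDedekindZeta (K := F) (S := S) (s := 2 * σ - 1) (by rw [h2m1]; linarith)
  have hden := hasProd_partialDedekindZeta (K := F) (S := S) (s := 2 * σ) (by rw [h2]; linarith)
  -- invert the denominator's Euler product
  have hdinv : HasProd (fun v : {v : HeightOneSpectrum (𝓞 F) // v ∉ S} => ((1 - (v.1.residueCard : ℂ) ^ (-(2 * σ)))⁻¹)⁻¹)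
      (partialStandardL S (fun _ => {1}) (2 * σ))⁻¹ := by
    have h := hden.1
    unfold HasProd at h ⊢
    simpa only [Finset.prod_inv_distrib] using h.inv₀ hden.2
  refine ⟨?_, div_ne_zero hnum.2 hden.2⟩
  have key : HasProd (fun v : {v : HeightOneSpectrum (𝓞 F) // v ∉ S} =>
        (1 - (v.1.residueCard : ℂ) ^ (-(2 * σ))) * (1 - (v.1.residueCard : ℂ) ^ (-(2 * σ - 1)))⁻¹)
      ((partialStandardL S (fun _ => {1}) (2 * σ))⁻¹ * partialStandardL S (fun _ => {1}) (2 * σ - 1)) :=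
    (hdinv.mul hnum.1).congr_fun fun v => by simp only [inv_inv]
  rwa [inv_mul_eq_div] at key

/-! ## §2 The denominator `ζ_F^S(2σ)` on the open half-plane `Re σ > ½`: holomorphic and zero-free -/

/-- **`σ ↦ ζ_F^S(2σ)` is holomorphic on `{Re σ > ½}`** (★ `differentiableOn_partialDedekindZeta` on `Re > 1`, composed with `σ ↦ 2σ`). [cite: NeukirchANT1999, Ch. VII (5.2)] -/
theorem differentiableOn_zeta_two_mul :
    DifferentiableOn ℂ (fun σ : ℂ => partialStandardL S (fun _ => ({1} : Multiset ℂ)) (2 * σ)) {σ : ℂ | 1 / 2 < σ.re} :=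
  differentiableOn_partialDedekindZeta.comp ((differentiableOn_const _).mul differentiableOn_id) fun σ hσ => by
    have hσ' : 1 / 2 < σ.re := hσ
    show 1 < (2 * σ).re
    rw [(re_two_mul_and_sub_one σ).1]; linarith

/-- **`ζ_F^S(2σ) ≠ 0` for `Re σ > ½`** (absolutely convergent Euler product). [cite: NeukirchANT1999, Ch. VII (5.2)] -/
theorem zeta_two_mul_ne_zero {σ : ℂ} (hσ : 1 / 2 < σ.re) : partialStandardL S (fun _ => ({1} : Multiset ℂ)) (2 * σ) ≠ 0 :=
  (hasProd_partialDedekindZeta (K := F) (S := S) (s := 2 * σ) (by rw [(re_two_mul_and_sub_one σ).1]; linarith)).2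

/-! ## §3 The numerator: `(σ − 1)·ζ_F^S(2σ−1)` is the restriction of an ENTIRE function, non-zero at `σ = 1` -/

/-- **THE NUMERATOR, POLE-FREE, WITH ITS RESIDUE: `(σ − 1)·ζ_F^S(2σ−1) = A(σ)` on `Re σ > 1`, `A` ENTIRE, `A(1) = ½·ρ_F·E_S(1) ≠ 0`** (`S` finite).
`A(σ) = ½·Z(2σ − 1)` where `Z(w) = (w − 1)ζ_F(w)E_S(w)` extended by `ρ_F E_S(1)` at `w = 1` is entire (★ `differentiable_update_sub_one_mul_zeta`) and equals `(w − 1)ζ_F^S(w)`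
for `Re w > 1`; `σ − 1 = ½·((2σ − 1) − 1)`.  Non-vanishing at `1`: ★ `residue_mul_thinEulerFactor_ne_zero`.  So `ζ_F^S(2σ−1)` has a GENUINE simple pole at `σ = 1`.
[cite: NeukirchANT1999, Ch. VII Cor. (5.11)] -/
theorem exists_entire_sub_one_mul_num (hS : S.Finite) :
    ∃ A : ℂ → ℂ, Differentiable ℂ A ∧
      (∀ σ : ℂ, 1 < σ.re → (σ - 1) * partialStandardL S (fun _ => ({1} : Multiset ℂ)) (2 * σ - 1) = A σ) ∧ A 1 ≠ 0 := by
  obtain ⟨hZ, hZ_eq⟩ := differentiable_update_sub_one_mul_zeta (F := F) (S := S) hS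
  set Z : ℂ → ℂ := Function.update (fun w : ℂ => (w - 1) *
        (dedekindZetaCont F w * ∏' v : S, (1 - ((v : HeightOneSpectrum (𝓞 F)).residueCard : ℂ) ^ (-w))))
        1 ((dedekindZeta_residue F : ℂ) * ∏' v : S, (1 - ((v : HeightOneSpectrum (𝓞 F)).residueCard : ℂ) ^ (-(1 : ℂ)))) with hZdef
  refine ⟨fun σ => 1 / 2 * Z (2 * σ - 1), ?_, fun σ hσ => ?_, ?_⟩
  · have h2 : Differentiable ℂ (fun σ : ℂ => 2 * σ - 1) := ((differentiable_const _).mul differentiable_id).sub (differentiable_const _)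
    exact (differentiable_const _).mul (hZ.comp h2)
  · have hw : 1 < (2 * σ - 1).re := by rw [(re_two_mul_and_sub_one σ).2]; linarith
    show (σ - 1) * partialStandardL S (fun _ => {1}) (2 * σ - 1) = 1 / 2 * Z (2 * σ - 1)
    rw [hZ_eq (2 * σ - 1) hw]
    ring
  · -- `A 1 = ½ · Z 1 = ½ · ρ_F · E_S(1) ≠ 0`
    have h1 : (2 * (1 : ℂ) - 1) = 1 := by norm_num
    show 1 / 2 * Z (2 * 1 - 1) ≠ 0
    rw [h1, hZdef, Function.update_self]
    exact mul_ne_zero (by norm_num) (residue_mul_thinEulerFactor_ne_zero (summable_residueCard_rpow_neg_of_finite hS 0) zero_lt_one)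

/-! ## §4 MAIN: `c^S(σ) = ζ_F^S(2σ−1)/ζ_F^S(2σ)` continues to `Re σ > ½` with exactly one pole there, simple, at `σ = 1` -/

/-- **R7₂-SCALAR — THE UNRAMIFIED INTERTWINING SCALAR OF `U(J₂)` ON `Re σ > ½`: ONE SIMPLE POLE, AT `σ = 1 = 2ρ_H`.**  For a number field `F` and a finite set `S` of
finite places there is `G` HOLOMORPHIC on `{Re σ > ½}` with, for `Re σ > 1`,
  `(σ − 1) · ζ_F^S(2σ−1)/ζ_F^S(2σ) = G(σ)`,   and   `G(1) ≠ 0`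
(`G = A/ζ_F^S(2·)`, §3 over §2).  Hence `c^S(σ) = G(σ)/(σ − 1)` is the meromorphic continuation of the Euler product of §1 to `Re σ > ½`: holomorphic off `σ = 1`, with a GENUINE simple
pole at `σ = 1` (residue `G(1) = ½·ρ_F·E_S(1)/ζ_F^S(2)`), and no other singularity on `Re σ > ½` — the `N = 2`, trivial-`K`-type instance of «the poles of `M(w₀, σ)` in `Re σ > ρ_H` are
finitely many, real, simple» [MoeglinWaldspurger1995 IV.1.11].  [cite: MoeglinWaldspurger1995, IV.1.11] [cite: Langlands1976, Appendix] [cite: NeukirchANT1999, Ch. VII Cor. (5.11)] -/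
theorem exists_differentiableOn_sub_one_mul_scalar (hS : S.Finite) :
    ∃ G : ℂ → ℂ, DifferentiableOn ℂ G {σ : ℂ | 1 / 2 < σ.re} ∧
      (∀ σ : ℂ, 1 < σ.re →
        (σ - 1) * (partialStandardL S (fun _ => ({1} : Multiset ℂ)) (2 * σ - 1) / partialStandardL S (fun _ => ({1} : Multiset ℂ)) (2 * σ)) = G σ) ∧
      G 1 ≠ 0 := by
  obtain ⟨A, hA, hA_eq, hA1⟩ := exists_entire_sub_one_mul_num (F := F) (S := S) hS
  refine ⟨fun σ => A σ / partialStandardL S (fun _ => ({1} : Multiset ℂ)) (2 * σ),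
    hA.differentiableOn.div differentiableOn_zeta_two_mul fun σ hσ => zeta_two_mul_ne_zero hσ, fun σ hσ => ?_, ?_⟩
  · show _ = A σ / _
    rw [← hA_eq σ hσ]
    ring
  · show A 1 / partialStandardL S (fun _ => ({1} : Multiset ℂ)) (2 * 1) ≠ 0
    exact div_ne_zero hA1 (zeta_two_mul_ne_zero (σ := 1) (by norm_num))

/-! ## §5 The denominator on the CLOSED half-plane `Re σ ≥ ½`: no zero off `σ = ½`, and the pole of `ζ_F(2σ)` at `σ = ½` -/

/-- **THE DENOMINATOR AT THE BOUNDARY `Re σ = ½`.**  `B(σ) = ζ_F(2σ)·E_S(2σ)` (`ζ_F =` ★ `dedekindZetaCont`, `E_S(w) = ∏'_{v∈S}(1 − q_v^{−w})`, `S` finite) is (i) holomorphic on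
`{Re σ > 0} ∖ {½}`, (ii) `= ζ_F^S(2σ)` on `{Re σ > ½}`, (iii) `≠ 0` for `Re σ ≥ ½`, `σ ≠ ½` (on `Re σ = ½`: Landau's `ζ_F(1 + it) ≠ 0`, ★ `dedekindZetaCont_mul_thinEulerFactor_ne_zero`),
and (iv) `(σ − ½)·B(σ) → r = ½·ρ_F·E_S(1) ≠ 0` on `𝓝[≠] ½` (the simple pole of `ζ_F(2σ)`; so `1/ζ_F^S(2σ)` is holomorphic near `Re σ ≥ ½` off `½` and tends to `0` at `½`).
Twin of ★ `K2LiuSiegelIntertwiningScalarGL1.exists_continuation_b_boundary` at `s = σ − ½`, `ε ↦ 1`. [cite: NeukirchANT1999, Ch. VII Cor. (5.11)] -/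
theorem exists_continuation_den_boundary (hS : S.Finite) :
    ∃ B : ℂ → ℂ, DifferentiableOn ℂ B ({σ : ℂ | 0 < σ.re} \ {1 / 2}) ∧
      (∀ σ : ℂ, 1 / 2 < σ.re → B σ = partialStandardL S (fun _ => ({1} : Multiset ℂ)) (2 * σ)) ∧
      (∀ σ : ℂ, 1 / 2 ≤ σ.re → σ ≠ 1 / 2 → B σ ≠ 0) ∧
      ∃ r : ℂ, r ≠ 0 ∧ Tendsto (fun σ : ℂ => (σ - 1 / 2) * B σ) (𝓝[≠] (1 / 2)) (𝓝 r) := by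
  have hS0 := summable_residueCard_rpow_neg_of_finite hS (0 : ℝ)
  set ZE : ℂ → ℂ := fun w : ℂ =>
    dedekindZetaCont F w * ∏' v : S, (1 - ((v : HeightOneSpectrum (𝓞 F)).residueCard : ℂ) ^ (-w)) with hZE
  have haff : Differentiable ℂ (fun σ : ℂ => 2 * σ) := (differentiable_const _).mul differentiable_id
  have htwo : ∀ σ : ℂ, (2 * σ : ℂ) = 1 ↔ σ = 1 / 2 := fun σ => by
    constructor
    · intro h; linear_combination h / 2
    · intro h; rw [h]; norm_num
  refine ⟨fun σ => ZE (2 * σ), ?_, fun σ hσ => ?_, fun σ hσ hσ0 => ?_, ?_⟩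
  · -- (i) holomorphy on `{Re σ > 0} ∖ {½}`
    exact (differentiableOn_dedekindZetaCont_mul_thinEulerFactor hS0).comp haff.differentiableOn fun σ hσ => by
      refine ⟨?_, fun h => hσ.2 ((htwo σ).1 h)⟩
      have hσ' : (0 : ℝ) < σ.re := hσ.1
      show (0 : ℝ) < (2 * σ).re
      rw [(re_two_mul_and_sub_one σ).1]; linarith
  · -- (ii) agreement with `ζ_F^S(2σ)` on `Re σ > ½`
    have hw : 1 < (2 * σ).re := by rw [(re_two_mul_and_sub_one σ).1]; linarith
    show ZE (2 * σ) = _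
    rw [hZE, partialDedekindZeta_eq_dedekindZetaCont_mul hS0 hw (zero_lt_one.trans hw)]
  · -- (iii) no zero on `Re σ ≥ ½`, `σ ≠ ½`
    have hw : 1 ≤ (2 * σ).re := by rw [(re_two_mul_and_sub_one σ).1]; linarith
    have hw1 : (2 * σ : ℂ) ≠ 1 := fun h => hσ0 ((htwo σ).1 h)
    exact dedekindZetaCont_mul_thinEulerFactor_ne_zero hS0 zero_lt_one hw hw1
  · -- (iv) the pole at `σ = ½`
    set r₀ : ℂ := (dedekindZeta_residue F : ℂ) *
      ∏' v : S, (1 - ((v : HeightOneSpectrum (𝓞 F)).residueCard : ℂ) ^ (-(1 : ℂ))) with hr₀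
    have hr₀0 : r₀ ≠ 0 := residue_mul_thinEulerFactor_ne_zero hS0 zero_lt_one
    refine ⟨1 / 2 * r₀, mul_ne_zero (by norm_num) hr₀0, ?_⟩
    -- `σ ↦ 2σ` maps `𝓝[≠] ½` into `𝓝[≠] 1`
    have hφ : Tendsto (fun σ : ℂ => 2 * σ) (𝓝[≠] (1 / 2 : ℂ)) (𝓝[≠] (1 : ℂ)) := by
      refine tendsto_nhdsWithin_of_tendsto_nhds_of_eventually_within _ ?_ ?_
      · have h := (haff.continuous.tendsto (1 / 2 : ℂ)).mono_left (nhdsWithin_le_nhds (s := ({(1 / 2 : ℂ)}ᶜ : Set ℂ)))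
        have h12 : (2 * (1 / 2 : ℂ)) = 1 := by norm_num
        rw [h12] at h
        exact h
      · filter_upwards [self_mem_nhdsWithin] with σ hσ
        exact fun h => hσ ((htwo σ).1 h)
    have hZlim : Tendsto (fun σ : ℂ => (2 * σ - 1) * ZE (2 * σ)) (𝓝[≠] (1 / 2 : ℂ)) (𝓝 r₀) :=
      (tendsto_sub_one_mul_dedekindZetaCont_mul_thinEulerFactor hS0 zero_lt_one).comp hφ
    have hlim := hZlim.const_mul (1 / 2 : ℂ)
    refine hlim.congr fun σ => ?_
    show 1 / 2 * ((2 * σ - 1) * ZE (2 * σ)) = (σ - 1 / 2) * ZE (2 * σ)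
    ring

/-! ## §6 Corollary: `1/ζ_F^S(2σ)` extends continuously to the CLOSED half-plane `Re σ ≥ ½`, vanishing exactly at `σ = ½` -/

/-- **CONTINUOUS EXTENSION OF `1/ζ_F^S(2σ)` TO `Re σ ≥ ½`** (`S` finite): there is `I : ℂ → ℂ`, CONTINUOUS ON the closed half-plane `{Re σ ≥ ½}`, equal to `(ζ_F^S(2σ))⁻¹` for
`Re σ > ½`, non-zero on `{Re σ ≥ ½} ∖ {½}` and with `I(½) = 0` (`I = 1/B` off `½`, §5 (i)(iii); at `½`, `1/B = (σ − ½)/((σ − ½)B) → 0/r = 0`, §5 (iv)).  This is the form in which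
the boundary line `Re σ = ½ = ρ_H` (the unitary axis of R7₂ ∕ R8) reads the scalar: `c^S(σ) = ζ_F^S(2σ−1)·I(σ)` has no pole from the denominator on the closed half-plane.
[cite: NeukirchANT1999, Ch. VII Cor. (5.11)] [cite: MoeglinWaldspurger1995, IV.1.11] -/
theorem exists_continuousOn_inv_den (hS : S.Finite) :
    ∃ I : ℂ → ℂ, ContinuousOn I {σ : ℂ | 1 / 2 ≤ σ.re} ∧
      (∀ σ : ℂ, 1 / 2 < σ.re → I σ = (partialStandardL S (fun _ => ({1} : Multiset ℂ)) (2 * σ))⁻¹) ∧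
      (∀ σ : ℂ, 1 / 2 ≤ σ.re → σ ≠ 1 / 2 → I σ ≠ 0) ∧ I (1 / 2) = 0 := by
  classical
  obtain ⟨B, hBd, hBeq, hB0, r, hr0, hBlim⟩ := exists_continuation_den_boundary (F := F) (S := S) hS
  refine ⟨Function.update (fun σ => (B σ)⁻¹) (1 / 2) 0, ?_, fun σ hσ => ?_, fun σ hσ hσ0 => ?_, Function.update_self _ _ _⟩
  · -- continuity on the closed half-plane: at `½` by the pole, elsewhere by holomorphy and non-vanishing of `B`
    intro σ hσ
    have hσ' : 1 / 2 ≤ σ.re := hσ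
    by_cases h : σ = 1 / 2
    · -- at `½`: `(B σ)⁻¹ = (σ − ½)/((σ − ½)·B σ) → 0`
      subst h
      refine (continuousWithinAt_update_same).2 ?_
      have hsub : Tendsto (fun σ : ℂ => σ - 1 / 2) (𝓝[≠] (1 / 2 : ℂ)) (𝓝 0) := by
        have h : Tendsto (fun σ : ℂ => σ - 1 / 2) (𝓝 (1 / 2 : ℂ)) (𝓝 ((1 / 2 : ℂ) - 1 / 2)) :=
          (continuous_id.sub continuous_const).tendsto (1 / 2 : ℂ)
        rw [sub_self] at h
        exact h.mono_left nhdsWithin_le_nhds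
      have hquot := hsub.div hBlim hr0
      rw [zero_div] at hquot
      have hev : ∀ᶠ σ : ℂ in 𝓝[≠] (1 / 2 : ℂ), (σ - 1 / 2) / ((σ - 1 / 2) * B σ) = (B σ)⁻¹ := by
        filter_upwards [self_mem_nhdsWithin] with σ hσ
        have hne : (σ - 1 / 2 : ℂ) ≠ 0 := sub_ne_zero.2 hσ
        rw [div_mul_eq_div_div, div_self hne, one_div]
      exact (hquot.congr' hev).mono_left (nhdsWithin_mono _ fun σ hσ => hσ.2)
    · -- off `½`: `B` is continuous at `σ` (holomorphic on the open set `{Re > 0} ∖ {½}` containing `σ`) and `B σ ≠ 0`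
      have hmem : σ ∈ {σ : ℂ | 0 < σ.re} \ {(1 / 2 : ℂ)} := ⟨show (0 : ℝ) < σ.re by linarith, h⟩
      have hopen : IsOpen ({σ : ℂ | 0 < σ.re} \ {(1 / 2 : ℂ)}) := (isOpen_lt continuous_const continuous_re).sdiff isClosed_singleton
      have hcont : ContinuousAt B σ := (hBd.differentiableAt (hopen.mem_nhds hmem)).continuousAt
      have hinv : ContinuousAt (fun σ => (B σ)⁻¹) σ := hcont.inv₀ (hB0 σ hσ' h)
      have hev : (fun σ' => Function.update (fun σ => (B σ)⁻¹) (1 / 2 : ℂ) (0 : ℂ) σ') =ᶠ[𝓝 σ] fun σ' => (B σ')⁻¹ := by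
        filter_upwards [isOpen_ne.mem_nhds h] with σ' hσ'
        exact Function.update_of_ne hσ' _ _
      exact (hinv.congr hev.symm).continuousWithinAt
  · have hne : σ ≠ 1 / 2 := fun h => by rw [h] at hσ; norm_num at hσ
    rw [Function.update_of_ne hne, hBeq σ hσ]
  · rw [Function.update_of_ne hσ0]
    exact inv_ne_zero (hB0 σ hσ hσ0)

end Summit.HodgeConjecture.HodgeConjecture.Cruxes.H413.K2E1IntertwiningScalarContinuationU2

end
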